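import Literature.NumberTheory.Automorphic.SymplecticGroupIwasawa
import Literature.NumberTheory.Automorphic.SymplecticGroupCartanUnique
import HarnessLib

/-!
# The Iwasawa exponents `a(g) ∈ ℤⁿ` of `g ∈ Sp_{2n}(K) = B(K) · Sp_{2n}(𝒪)`: the torus part of the Iwasawa decomposition is
# unique up to units, right `Sp_{2n}(𝒪)`-invariant and left `B(K)`-additive

Topic `NumberTheory/Automorphic`; namespace `Literature.NumberTheory.Automorphic.SymplecticCartan` (lane `lit-hodgefound`,
Track 2 foundations; seat `lit-hodgefound-p11`, generation 37, row g37-#4).  One definition with body (`symplecticIwasawaExp`)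
+ theorems; no named fact, no instance, no notation.  Sequel of `SymplecticGroupIwasawa` (`symplecticBorel`, the decomposition
`exists_mem_symplecticBorel_mul_symplecticInt`).

Setting: `K` a field with `Valued K ℤᵐ⁰`, uniformiser `ϖ`; `Sp(J, K) = symplecticGroup (Fin n) K` for Mathlib's `J`,
`K₀ = Sp(J, 𝒪) = symplecticInt`, `B = symplecticBorel n K` (upper triangular for the Borel order `inr 0 < ⋯ < inr (n-1) <
inl (n-1) < ⋯ < inl 0`).  The diagonal of `p ∈ B` satisfies `p_{inr i,inr i} · p_{inl i,inl i} = 1` (§2: the `inl`- and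
`inr`-diagonal entries are mutually inverse, so the torus of `B` is `{diag(t⁻¹ on inl; t on inr)}`).  The **Iwasawa exponent**
of `g = p k` is `a(g)ᵢ = ord p_{inl i, inl i} = -ord p_{inr i, inr i} ∈ ℤ` (so that the Cartan representative
`diag(ϖ^{a} ; ϖ^{-a})` of `SymplecticGroupCartanDecomposition` has exponent `a`); it is well defined because `B ∩ K₀` has unit
diagonal (§3–§4).

## The print

[BruhatTits1972] §4.4, Prop. (4.4.3) (1): for a good maximal compact `K̂` the map `z ↦ U z K̂` induces a bijection of
`Z/(Z ∩ K̂)` onto `U\G/K̂` — the `N A K` decomposition with `A`-part unique modulo `A ∩ K` (here for hyperspecial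
`Sp_{2n}(𝒪)`, elementary proof); [CartierCorvallis1979] §IV (4.2) («`G = N A K` … `a(g)` well defined modulo
`A ∩ K = A(𝒪)`»), the exponent map `G/K → A/A(𝒪) = Λ = X_*(A)` feeding the Satake transform; [Macdonald1995] Ch. V §2 (2.5)
(`GL_n`: «each coset has a representative `u ϖ^λ`, `λ` unique»); [AndrianovZhuravlev1995] Ch. 3 §3.3 (3.44)–(3.46): the
spherical map reads the diagonal `(d₁, …, d_n)` of the triangular representative `(A B; 0 D)`.  For the tree's `GL_n` and
unitary versions see `SatakeTransformGL.iwasawaExp`, `HyperspecialUnitaryIwasawaExponents`.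

## What is formalised

* §1 diagonal calculus of block-triangular matrices for an injective order map: `(M N)ᵢᵢ = Mᵢᵢ Nᵢᵢ`, `(M⁻¹)ᵢᵢ = Mᵢᵢ⁻¹`.
* §2 `apply_inr_mul_apply_inl_eq_one` (`p ∈ B ⇒ p_{inr i,inr i} p_{inl i,inl i} = 1`), non-vanishing.
* §3 `v_apply_inl_eq_one_of_mem_inf` (`B ∩ K₀` has unit diagonal), `v_apply_inl_eq_of_mul_eq` (the torus part of `g = p k` is
  unique up to units).
* §4 **`symplecticIwasawaExp hϖ g : Fin n → ℤ`**, `v_apply_inl_eq_exp_neg` (any decomposition computes it),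
  **`symplecticIwasawaExp_mul_of_mem_symplecticInt`** (right `K₀`-invariance), **`symplecticIwasawaExp_mul_of_mem_symplecticBorel`**
  (left `B`-additivity), `symplecticIwasawaExp_one`, `_of_mem_symplecticInt`, `_of_mem_symplecticBorel`,
  `symplecticIwasawaExp_diagonal` (the Cartan representative `diag(ϖ^{a}; ϖ^{-a})` has exponent `a`).

## References
* [BruhatTits1972] F. Bruhat, J. Tits, Publ. Math. IHÉS 41 (1972), §4.4 Prop. (4.4.3).
* [CartierCorvallis1979] P. Cartier, PSPM 33.1 (1979), §IV (4.2).
* [Macdonald1995] I. G. Macdonald, *Symmetric Functions and Hall Polynomials*, 2nd ed., Ch. V §2 (2.5).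
* [AndrianovZhuravlev1995] A. N. Andrianov, V. G. Zhuravlev, Transl. Math. Monogr. 145, Ch. 3 §3.3 (3.44)–(3.46).
-/

noncomputable section

open scoped Valued WithZero
open Matrix
open LinearMap (BilinForm)

namespace Literature.NumberTheory.Automorphic.SymplecticCartan

open Literature.NumberTheory.Automorphic.HermitianLattice

variable {K : Type*} [Field K] {n : ℕ}

/-! ## §1 Diagonal entries of block-triangular matrices -/

/-- `(M N)ᵢᵢ = Mᵢᵢ Nᵢᵢ` for `M`, `N` block triangular w.r.t. an INJECTIVE order map. [cite: Macdonald1995, Ch. V §2 (2.5)] -/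
theorem blockTriangular_mul_apply_self {m α : Type*} [Fintype m] [LinearOrder α] {b : m → α} (hb : Function.Injective b)
    {M N : Matrix m m K} (hM : M.BlockTriangular b) (hN : N.BlockTriangular b) (i : m) :
    (M * N) i i = M i i * N i i := by
  rw [Matrix.mul_apply, Finset.sum_eq_single i]
  · intro l _ hl
    rcases lt_or_gt_of_ne (fun h => hl (hb h)) with h | h
    · rw [hM h, zero_mul]
    · rw [hN h, mul_zero]
  · intro h; exact absurd (Finset.mem_univ i) h

/-- `(M⁻¹)ᵢᵢ Mᵢᵢ = 1` for an invertible block-triangular `M` (injective order map): the diagonal of the inverse is the inverse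
of the diagonal. [cite: Macdonald1995, Ch. V §2 (2.5)] -/
theorem blockTriangular_inv_apply_self_mul {m α : Type*} [Fintype m] [DecidableEq m] [LinearOrder α] {b : m → α}
    (hb : Function.Injective b) {M : Matrix m m K} (hM : M.BlockTriangular b) (hdet : IsUnit M.det) (i : m) :
    M⁻¹ i i * M i i = 1 := by
  haveI := Matrix.invertibleOfIsUnitDet M hdet
  have hinv : M⁻¹.BlockTriangular b := Matrix.blockTriangular_inv_of_blockTriangular hM
  have h := congrFun (congrFun (Matrix.nonsing_inv_mul M hdet) i) i
  rwa [blockTriangular_mul_apply_self hb hinv hM, Matrix.one_apply_eq] at h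

/-! ## §2 The diagonal of a Borel element: `p_{inr i, inr i} · p_{inl i, inl i} = 1` -/

/-- **The torus of the symplectic Borel**: for `p ∈ B(K)`, `p_{inr i, inr i} · p_{inl i, inl i} = 1`
(`1 = B_J(e_{inr i}, e_{inl i}) = B_J(p e_{inr i}, p e_{inl i})`, and block-triangularity kills every other term).
[cite: AndrianovZhuravlev1995, Ch. 3 §3.3 (3.44); Ch. 1 §3 Prop. 3.7] -/
theorem apply_inr_mul_apply_inl_eq_one {p : symplecticGroup (Fin n) K} (hp : p ∈ symplecticBorel n K) (i : Fin n) :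
    (p : Matrix (Fin n ⊕ Fin n) (Fin n ⊕ Fin n) K) (Sum.inr i) (Sum.inr i) *
      (p : Matrix (Fin n ⊕ Fin n) (Fin n ⊕ Fin n) K) (Sum.inl i) (Sum.inl i) = 1 := by
  obtain ⟨h₁, h₂, h₃⟩ := (blockTriangular_symplecticBorelOrder_iff _).1 (mem_symplecticBorel_iff.1 hp)
  have hform := toLinearMap₂'_J_mulVec p.2 (Pi.single (Sum.inr i) (1 : K)) (Pi.single (Sum.inl i) (1 : K))
  rw [toLinearMap₂'_J_apply, toLinearMap₂'_J_apply] at hform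
  simp only [Matrix.mulVec_single_one, Matrix.col_apply, Pi.single_apply, Sum.inr.injEq, Sum.inl.injEq, reduceCtorEq,
    if_false, mul_zero, sub_zero, mul_ite, mul_one] at hform
  rw [Finset.sum_ite_eq' Finset.univ i, if_pos (Finset.mem_univ _)] at hform
  -- the left sum: only `k = i` survives
  rw [Finset.sum_eq_single i] at hform
  · simpa [h₁] using hform
  · intro k _ hki
    rcases lt_or_gt_of_ne hki with h | h
    · rw [h₃ k i h, mul_zero, h₁, zero_mul, sub_zero]
    · rw [h₂ k i h, zero_mul, h₁, zero_mul, sub_zero]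
  · intro h; exact absurd (Finset.mem_univ i) h

/-- The `inl`-diagonal entries of a Borel element are non-zero. [cite: AndrianovZhuravlev1995, Ch. 3 §3.3 (3.44)] -/
theorem apply_inl_ne_zero {p : symplecticGroup (Fin n) K} (hp : p ∈ symplecticBorel n K) (i : Fin n) :
    (p : Matrix (Fin n ⊕ Fin n) (Fin n ⊕ Fin n) K) (Sum.inl i) (Sum.inl i) ≠ 0 := fun h => by
  have := apply_inr_mul_apply_inl_eq_one hp i
  rw [h, mul_zero] at this
  exact zero_ne_one this

/-- The `inr`-diagonal entries of a Borel element are non-zero. [cite: AndrianovZhuravlev1995, Ch. 3 §3.3 (3.44)] -/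
theorem apply_inr_ne_zero {p : symplecticGroup (Fin n) K} (hp : p ∈ symplecticBorel n K) (i : Fin n) :
    (p : Matrix (Fin n ⊕ Fin n) (Fin n ⊕ Fin n) K) (Sum.inr i) (Sum.inr i) ≠ 0 := fun h => by
  have := apply_inr_mul_apply_inl_eq_one hp i
  rw [h, zero_mul] at this
  exact zero_ne_one this

/-- Multiplicativity of the `inl`-diagonal on `B(K)`: `(p q)_{inl i, inl i} = p_{inl i, inl i} q_{inl i, inl i}`.
[cite: Macdonald1995, Ch. V §2 (2.5)] -/
theorem mul_apply_inl (p q : symplecticGroup (Fin n) K) (hp : p ∈ symplecticBorel n K) (hq : q ∈ symplecticBorel n K)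
    (i : Fin n) :
    ((p * q : symplecticGroup (Fin n) K) : Matrix (Fin n ⊕ Fin n) (Fin n ⊕ Fin n) K) (Sum.inl i) (Sum.inl i) =
      (p : Matrix (Fin n ⊕ Fin n) (Fin n ⊕ Fin n) K) (Sum.inl i) (Sum.inl i) *
        (q : Matrix (Fin n ⊕ Fin n) (Fin n ⊕ Fin n) K) (Sum.inl i) (Sum.inl i) :=
  blockTriangular_mul_apply_self symplecticBorelOrder_injective hp hq _

/-- The `inl`-diagonal of the inverse: `(p⁻¹)_{inl i, inl i} p_{inl i, inl i} = 1`. [cite: Macdonald1995, Ch. V §2 (2.5)] -/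
theorem inv_apply_inl_mul {p : symplecticGroup (Fin n) K} (hp : p ∈ symplecticBorel n K) (i : Fin n) :
    ((p⁻¹ : symplecticGroup (Fin n) K) : Matrix (Fin n ⊕ Fin n) (Fin n ⊕ Fin n) K) (Sum.inl i) (Sum.inl i) *
      (p : Matrix (Fin n ⊕ Fin n) (Fin n ⊕ Fin n) K) (Sum.inl i) (Sum.inl i) = 1 := by
  have h := mul_apply_inl p⁻¹ p ((symplecticBorel n K).inv_mem hp) hp i
  rw [inv_mul_cancel] at h
  rw [← h]
  change (1 : Matrix (Fin n ⊕ Fin n) (Fin n ⊕ Fin n) K) (Sum.inl i) (Sum.inl i) = 1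
  rw [Matrix.one_apply_eq]

/-! ## §3 `B ∩ K₀` has unit diagonal; the torus part is unique up to units -/

section Valued

variable [Valued K ℤᵐ⁰] {ϖ : K}

/-- **`B(K) ∩ Sp(J, 𝒪)` has unit diagonal**: `v(k_{inl i, inl i}) = 1` (both `k` and `k⁻¹` are integral and their
`inl`-diagonals are mutually inverse). [cite: CartierCorvallis1979, §IV (4.2); BruhatTits1972, §4.4 Prop. 4.4.3] -/
theorem v_apply_inl_eq_one_of_mem {k : symplecticGroup (Fin n) K} (hkB : k ∈ symplecticBorel n K)
    (hkK : k ∈ symplecticInt (Fin n) K) (i : Fin n) :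
    Valued.v ((k : Matrix (Fin n ⊕ Fin n) (Fin n ⊕ Fin n) K) (Sum.inl i) (Sum.inl i)) = 1 := by
  have h1 : Valued.v ((k : Matrix (Fin n ⊕ Fin n) (Fin n ⊕ Fin n) K) (Sum.inl i) (Sum.inl i)) ≤ 1 :=
    mem_symplecticInt_iff.1 hkK _ _
  have h2 : Valued.v (((k⁻¹ : symplecticGroup (Fin n) K) : Matrix (Fin n ⊕ Fin n) (Fin n ⊕ Fin n) K) (Sum.inl i) (Sum.inl i))
      ≤ 1 := mem_symplecticInt_iff.1 ((symplecticInt (Fin n) K).inv_mem hkK) _ _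
  have h := congrArg Valued.v (inv_apply_inl_mul hkB i)
  rw [map_mul, map_one] at h
  refine le_antisymm h1 ?_
  calc (1 : ℤᵐ⁰) = _ * _ := h.symm
    _ ≤ 1 * Valued.v ((k : Matrix (Fin n ⊕ Fin n) (Fin n ⊕ Fin n) K) (Sum.inl i) (Sum.inl i)) := mul_le_mul' h2 le_rfl
    _ = _ := one_mul _

/-- The `inr`-diagonal of `B ∩ K₀` consists of units too. [cite: CartierCorvallis1979, §IV (4.2)] -/
theorem v_apply_inr_eq_one_of_mem {k : symplecticGroup (Fin n) K} (hkB : k ∈ symplecticBorel n K)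
    (hkK : k ∈ symplecticInt (Fin n) K) (i : Fin n) :
    Valued.v ((k : Matrix (Fin n ⊕ Fin n) (Fin n ⊕ Fin n) K) (Sum.inr i) (Sum.inr i)) = 1 := by
  have h := congrArg Valued.v (apply_inr_mul_apply_inl_eq_one hkB i)
  rwa [map_mul, v_apply_inl_eq_one_of_mem hkB hkK i, mul_one, map_one] at h

/-- **The torus part of the Iwasawa decomposition is unique up to units**: if `p k = p' k'` with `p, p' ∈ B(K)` and
`k, k' ∈ Sp(J, 𝒪)` then `v(p_{inl i, inl i}) = v(p'_{inl i, inl i})` for all `i` (`p⁻¹ p' = k k'⁻¹ ∈ B ∩ K₀`).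
[cite: BruhatTits1972, §4.4 Prop. 4.4.3; Macdonald1995, Ch. V §2 (2.5)] -/
theorem v_apply_inl_eq_of_mul_eq {p p' k k' : symplecticGroup (Fin n) K} (hp : p ∈ symplecticBorel n K)
    (hp' : p' ∈ symplecticBorel n K) (hk : k ∈ symplecticInt (Fin n) K) (hk' : k' ∈ symplecticInt (Fin n) K)
    (h : p * k = p' * k') (i : Fin n) :
    Valued.v ((p : Matrix (Fin n ⊕ Fin n) (Fin n ⊕ Fin n) K) (Sum.inl i) (Sum.inl i)) =
      Valued.v ((p' : Matrix (Fin n ⊕ Fin n) (Fin n ⊕ Fin n) K) (Sum.inl i) (Sum.inl i)) := by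
  -- `c := p⁻¹ p' = k k'⁻¹ ∈ B ∩ K₀`
  have hc : p⁻¹ * p' = k * k'⁻¹ := by
    rw [inv_mul_eq_iff_eq_mul, ← mul_assoc, h, mul_assoc, mul_inv_cancel, mul_one]
  have hcB : p⁻¹ * p' ∈ symplecticBorel n K := (symplecticBorel n K).mul_mem ((symplecticBorel n K).inv_mem hp) hp'
  have hcK : p⁻¹ * p' ∈ symplecticInt (Fin n) K :=
    hc ▸ (symplecticInt (Fin n) K).mul_mem hk ((symplecticInt (Fin n) K).inv_mem hk')
  have hunit := v_apply_inl_eq_one_of_mem hcB hcK i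
  -- `p' = p c`
  have hp'eq : p' = p * (p⁻¹ * p') := by rw [mul_inv_cancel_left]
  rw [hp'eq, mul_apply_inl p (p⁻¹ * p') hp hcB, map_mul, hunit, mul_one]

/-! ## §4 The Iwasawa exponents -/

/-- **The Iwasawa exponents** `a(g) ∈ ℤⁿ` of `g ∈ Sp(J, K)`: `a(g)ᵢ = ord p_{inl i, inl i} = -log v(p_{inl i, inl i})` for ANY
decomposition `g = p k`, `p ∈ B(K)`, `k ∈ Sp(J, 𝒪)` (here: the one chosen by `exists_mem_symplecticBorel_mul_symplecticInt`;
independence: `v_apply_inl_eq_exp_neg`).  The torus element `diag(ϖ^{a}; ϖ^{-a})` has exponent `a`.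
[cite: CartierCorvallis1979, §IV (4.2); BruhatTits1972, §4.4 Prop. 4.4.3] -/
def symplecticIwasawaExp (hϖ : Valued.v ϖ = WithZero.exp (-1 : ℤ)) (g : symplecticGroup (Fin n) K) : Fin n → ℤ :=
  fun i => -WithZero.log (Valued.v
    (((exists_mem_symplecticBorel_mul_symplecticInt hϖ g).choose : Matrix (Fin n ⊕ Fin n) (Fin n ⊕ Fin n) K)
      (Sum.inl i) (Sum.inl i)))

/-- **Any Iwasawa decomposition computes the exponents**: if `g = p k` (`p ∈ B(K)`, `k ∈ Sp(J, 𝒪)`) then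
`v(p_{inl i, inl i}) = exp(-a(g)ᵢ)`. [cite: BruhatTits1972, §4.4 Prop. 4.4.3; CartierCorvallis1979, §IV (4.2)] -/
theorem v_apply_inl_eq_exp_neg (hϖ : Valued.v ϖ = WithZero.exp (-1 : ℤ)) {g p k : symplecticGroup (Fin n) K}
    (hp : p ∈ symplecticBorel n K) (hk : k ∈ symplecticInt (Fin n) K) (h : g = p * k) (i : Fin n) :
    Valued.v ((p : Matrix (Fin n ⊕ Fin n) (Fin n ⊕ Fin n) K) (Sum.inl i) (Sum.inl i)) =
      WithZero.exp (-symplecticIwasawaExp hϖ g i) := by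
  obtain ⟨k₀, hp₀, hk₀, h₀⟩ := (exists_mem_symplecticBorel_mul_symplecticInt hϖ g).choose_spec
  rw [symplecticIwasawaExp, neg_neg, v_apply_inl_eq_of_mul_eq hp hp₀ hk hk₀ (h.symm.trans h₀) i, WithZero.exp_log]
  exact (Valuation.ne_zero_iff _).2 (apply_inl_ne_zero hp₀ i)

/-- The exponent from any decomposition, logarithmic form: `a(g)ᵢ = -log v(p_{inl i, inl i})`.
[cite: CartierCorvallis1979, §IV (4.2)] -/
theorem symplecticIwasawaExp_eq (hϖ : Valued.v ϖ = WithZero.exp (-1 : ℤ)) {g p k : symplecticGroup (Fin n) K}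
    (hp : p ∈ symplecticBorel n K) (hk : k ∈ symplecticInt (Fin n) K) (h : g = p * k) (i : Fin n) :
    symplecticIwasawaExp hϖ g i =
      -WithZero.log (Valued.v ((p : Matrix (Fin n ⊕ Fin n) (Fin n ⊕ Fin n) K) (Sum.inl i) (Sum.inl i))) := by
  rw [v_apply_inl_eq_exp_neg hϖ hp hk h i, WithZero.log_exp, neg_neg]

/-- **Right `Sp(J, 𝒪)`-invariance**: `a(g k) = a(g)`. [cite: CartierCorvallis1979, §IV (4.2)] -/
theorem symplecticIwasawaExp_mul_of_mem_symplecticInt (hϖ : Valued.v ϖ = WithZero.exp (-1 : ℤ))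
    (g : symplecticGroup (Fin n) K) {k : symplecticGroup (Fin n) K} (hk : k ∈ symplecticInt (Fin n) K) :
    symplecticIwasawaExp hϖ (g * k) = symplecticIwasawaExp hϖ g := by
  obtain ⟨p, k₀, hp, hk₀, h⟩ := exists_mem_symplecticBorel_mul_symplecticInt hϖ g
  funext i
  rw [symplecticIwasawaExp_eq hϖ hp hk₀ h i,
    symplecticIwasawaExp_eq hϖ hp ((symplecticInt (Fin n) K).mul_mem hk₀ hk) (by rw [h, mul_assoc]) i]

/-- **Left `B(K)`-additivity**: `a(q g) = a(q) + a(g)` for `q ∈ B(K)`. [cite: CartierCorvallis1979, §IV (4.2)] -/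
theorem symplecticIwasawaExp_mul_of_mem_symplecticBorel (hϖ : Valued.v ϖ = WithZero.exp (-1 : ℤ))
    {q : symplecticGroup (Fin n) K} (hq : q ∈ symplecticBorel n K) (g : symplecticGroup (Fin n) K) :
    symplecticIwasawaExp hϖ (q * g) = symplecticIwasawaExp hϖ q + symplecticIwasawaExp hϖ g := by
  obtain ⟨p, k, hp, hk, h⟩ := exists_mem_symplecticBorel_mul_symplecticInt hϖ g
  funext i
  rw [Pi.add_apply, symplecticIwasawaExp_eq hϖ hp hk h i,
    symplecticIwasawaExp_eq hϖ hq (symplecticInt (Fin n) K).one_mem (mul_one q).symm i,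
    symplecticIwasawaExp_eq hϖ ((symplecticBorel n K).mul_mem hq hp) hk (by rw [h, mul_assoc]) i,
    mul_apply_inl q p hq hp i, map_mul, WithZero.log_mul, neg_add]
  · exact (Valuation.ne_zero_iff _).2 (apply_inl_ne_zero hq i)
  · exact (Valuation.ne_zero_iff _).2 (apply_inl_ne_zero hp i)

/-- `a(1) = 0`. [cite: CartierCorvallis1979, §IV (4.2)] -/
theorem symplecticIwasawaExp_one (hϖ : Valued.v ϖ = WithZero.exp (-1 : ℤ)) :
    symplecticIwasawaExp hϖ (1 : symplecticGroup (Fin n) K) = 0 := by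
  funext i
  rw [symplecticIwasawaExp_eq hϖ (symplecticBorel n K).one_mem (symplecticInt (Fin n) K).one_mem (mul_one _).symm i,
    Pi.zero_apply]
  change -WithZero.log (Valued.v ((1 : Matrix (Fin n ⊕ Fin n) (Fin n ⊕ Fin n) K) (Sum.inl i) (Sum.inl i))) = 0
  rw [Matrix.one_apply_eq, map_one, WithZero.log_one, neg_zero]

/-- `a(k) = 0` for `k ∈ Sp(J, 𝒪)`. [cite: CartierCorvallis1979, §IV (4.2)] -/
theorem symplecticIwasawaExp_of_mem_symplecticInt (hϖ : Valued.v ϖ = WithZero.exp (-1 : ℤ)) {k : symplecticGroup (Fin n) K}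
    (hk : k ∈ symplecticInt (Fin n) K) : symplecticIwasawaExp hϖ k = 0 := by
  rw [← one_mul k, symplecticIwasawaExp_mul_of_mem_symplecticInt hϖ 1 hk, symplecticIwasawaExp_one]

/-- `a(p)ᵢ = -log v(p_{inl i, inl i})` for `p ∈ B(K)`. [cite: CartierCorvallis1979, §IV (4.2)] -/
theorem symplecticIwasawaExp_of_mem_symplecticBorel (hϖ : Valued.v ϖ = WithZero.exp (-1 : ℤ)) {p : symplecticGroup (Fin n) K}
    (hp : p ∈ symplecticBorel n K) (i : Fin n) :
    symplecticIwasawaExp hϖ p i =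
      -WithZero.log (Valued.v ((p : Matrix (Fin n ⊕ Fin n) (Fin n ⊕ Fin n) K) (Sum.inl i) (Sum.inl i))) :=
  symplecticIwasawaExp_eq hϖ hp (symplecticInt (Fin n) K).one_mem (mul_one p).symm i

omit [Valued K ℤᵐ⁰] in
/-- The Cartan/torus representative `diag(ϖ^{a}; ϖ^{-a})` lies in the Borel subgroup. [cite: AndrianovZhuravlev1995, Ch. 3 §3 Lemma 3.6] -/
theorem diagonal_mem_symplecticBorel (hϖ0 : ϖ ≠ 0) (a : Fin n → ℕ) :
    (⟨Matrix.diagonal (Sum.elim (fun i => ϖ ^ a i) (fun i => (ϖ ^ a i)⁻¹)), diagonal_pow_mem_symplecticGroup hϖ0 a⟩ :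
      symplecticGroup (Fin n) K) ∈ symplecticBorel n K :=
  Matrix.blockTriangular_diagonal _

/-- **The exponent of the Cartan representative**: `a(diag(ϖ^{a}; ϖ^{-a})) = a`. [cite: AndrianovZhuravlev1995, Ch. 3 §3 Lemma 3.6; BruhatTits1972, §4.4 Prop. 4.4.3] -/
theorem symplecticIwasawaExp_diagonal (hϖ : Valued.v ϖ = WithZero.exp (-1 : ℤ)) (a : Fin n → ℕ) :
    symplecticIwasawaExp hϖ (⟨Matrix.diagonal (Sum.elim (fun i => ϖ ^ a i) (fun i => (ϖ ^ a i)⁻¹)),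
        diagonal_pow_mem_symplecticGroup (CartanUnique.uniformizer_ne_zero hϖ) a⟩ : symplecticGroup (Fin n) K) =
      fun i => (a i : ℤ) := by
  funext i
  rw [symplecticIwasawaExp_of_mem_symplecticBorel hϖ (diagonal_mem_symplecticBorel (CartanUnique.uniformizer_ne_zero hϖ) a) i]
  change -WithZero.log (Valued.v (Matrix.diagonal (Sum.elim (fun i => ϖ ^ a i) (fun i => (ϖ ^ a i)⁻¹)) (Sum.inl i) (Sum.inl i)))
    = (a i : ℤ)
  rw [Matrix.diagonal_apply_eq, Sum.elim_inl, map_pow, hϖ, ← WithZero.exp_nsmul, WithZero.log_exp]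
  simp

end Valued

end Literature.NumberTheory.Automorphic.SymplecticCartan

end
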